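import Summits.FinalStateConjecture.FinalStateConjecture.Theorems.ExactKerrEndsSettlingAlongCensoredKerrEndsFromSummit
import Literature.Geometry.Lorentzian.TameGaugedFamily
import Literature.Geometry.Lorentzian.CauchyDevelopmentPrecomp
import HarnessLib

/-!
# The Final State Conjecture NEEDS ONLY TAME CURVES: injectivity and immersion of its witness curves
# are gauge-borne (recorded on crux `SettlingAlongCensoredKerrEnds`, stmt-FinalStateConjecture-18520,
# whose relation to the summit is the subject of `…SettlingAlongCensoredKerrEndsFromSummit.lean`)

The summit statement `FinalStateConjecture` is tame Christodoulou genericity of codimension one, in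
`admissibleVacuumData X`, of the property
`Good D := (∃ MGHD of D) ∧ Settled D` (every maximal vacuum Cauchy development has complete `𝓘⁺` and
settles down): through every admissible datum failing `Good` must pass a tame, INJECTIVE, IMMERSED
curve of admissible data whose members off `0` are good. This file proves that the two gauge conditions
can be dropped from every witness obligation of the summit:

  `finalStateConjecture_of_tameCurves : TameGoodCurves → FinalStateConjecture`,

`TameGoodCurves` (displayed verbatim) asking through every admissible non-good datum merely for SOME
tame curve of admissible data with good members off `0`. It is the instance `P := Good` of the
Literature theorem `InitialDataSet.isTameChristodoulouGeneric_one_of_tameCurves`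
(`Literature/Geometry/Lorentzian/TameGaugedFamily.lean`: the gauged family — breathing deformation of the
quadratically reparametrised curve — is tame on a collar, immersed at `0`, admissible, and carries
every breathing-invariant property; injectivity on a window), `Good` being invariant under the
breathing deformations of every end: maximal developments re-index along diffeomorphisms of `X`
(`exists_isMaximal_breatheFamily`, by `VacuumCauchyDevelopment.IsMaximal.precomp`) and `Settled` does
(`settled_breatheFamily`). Every route of the summit may therefore end its witness construction in a
merely tame curve.

References: Christodoulou, CQG 16 (1999) A23, p. A24; Choquet-Bruhat–Geroch, CMP 14 (1969), p. 330;
Ringström 2009, Def. 16.5; Dafermos–Luk 2017, Conj. 1.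
-/

-- the doubled `FinalStateConjecture.FinalStateConjecture` path component trips dupNamespace
set_option linter.dupNamespace false

noncomputable section

open Set Function Filter TopologicalSpace
open scoped Manifold ContDiff Topology

namespace Summit.FinalStateConjecture.FinalStateConjecture.Theorems.ExactKerrEnds

open Literature.Geometry.Lorentzian
open Summit.FinalStateConjecture (HasCompleteNullInfinity exteriorOf RaysStayInClosure HasExhaustiveCharts
  IsFutureOriented)
open Summit.FinalStateConjecture.FinalStateConjecture.Theorems.PhaseMixingCaptureCaptureSufficesC2
  (injective_mfderiv_homeomorph_symm)

section Breathing

variable {X : Type} [TopologicalSpace X] [ChartedSpace E3 X] [IsManifold (𝓡 3) ∞ X] [T2Space X]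
  [ConnectedSpace X] {e : AFEnd X} {z₀ : E3} {r : ℝ} (B : AFEnd.BreathingData e z₀ r)
  (d : InitialDataSet (𝓡 3) X)

/-- **The existence of a maximal vacuum Cauchy development passes from `d` to every member of its
breathing family**: the member `(breathe (σ t))^* d` is the re-indexing of `d` along the breathing
diffeomorphism, and re-indexing a maximal development keeps it maximal
(`VacuumCauchyDevelopment.IsMaximal.precomp`). [cite: ChoquetBruhatGeroch1969CMP, p. 330] -/
theorem exists_isMaximal_breatheFamily (t : ℝ) (h : ∃ 𝒟 : VacuumCauchyDevelopment d, 𝒟.IsMaximal) :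
    ∃ 𝒟 : VacuumCauchyDevelopment (AFEnd.breatheFamily B d t), 𝒟.IsMaximal := by
  obtain ⟨𝒟, h𝒟⟩ := h
  set Φ : X ≃ₜ X := AFEnd.breatheHomeomorph B (AFEnd.abs_squash_lt_invScale B t) with hΦdef
  have hΦ : ContMDiff (𝓡 3) (𝓡 3) (∞ + 1) Φ :=
    AFEnd.contMDiff_breathe_succ B (AFEnd.abs_squash_lt_scale B t).2
  have hΦ' : ∀ u, Injective (mfderiv (𝓡 3) (𝓡 3) Φ u) :=
    (AFEnd.breatheScale_spec B).2.2 _ (AFEnd.abs_squash_lt_scale B t).1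
  have hΨ : ContMDiff (𝓡 3) (𝓡 3) (∞ + 1) Φ.symm := AFEnd.contMDiff_unbreathe B _
  have hΨ' : ∀ u, Injective (mfderiv (𝓡 3) (𝓡 3) Φ.symm u) :=
    injective_mfderiv_homeomorph_symm Φ hΦ hΨ
  have key : AFEnd.breatheFamily B d t = d.comap Φ hΦ hΦ' := rfl
  rw [key]
  exact ⟨𝒟.precomp Φ hΦ hΦ', VacuumCauchyDevelopment.IsMaximal.precomp 𝒟 Φ hΦ hΦ' h𝒟 hΨ hΨ'⟩

end Breathing

/-- **The Final State Conjecture needs only TAME curves.** If through every admissible datum `d` which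
is NOT good (good = an MGHD exists and every maximal vacuum Cauchy development has complete `𝓘⁺` and
settles down, verbatim the property of the summit statement) passes SOME tame curve `H` of admissible
data with `H 0 = d` whose members off `0` are good — no injectivity, no immersion — then
`FinalStateConjecture` holds: the injective immersed witness is the gauge-borne upgrade of `H`
(`InitialDataSet.isTameChristodoulouGeneric_one_of_tameCurves` for the breathing-invariant property
"good", `exists_isMaximal_breatheFamily` + `settled_breatheFamily`). [cite: Christodoulou1999, p. A24] -/
theorem finalStateConjecture_of_tameCurves :
    (∀ (X : Type) [TopologicalSpace X] [ChartedSpace E3 X] [IsManifold (𝓡 3) ∞ X] [T2Space X]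
      [SecondCountableTopology X] [ConnectedSpace X],
      ∀ d ∈ admissibleVacuumData X,
        ¬ ((∃ 𝒟 : VacuumCauchyDevelopment d, 𝒟.IsMaximal) ∧
            ∀ 𝒟 : VacuumCauchyDevelopment d, 𝒟.IsMaximal →
              Summit.FinalStateConjecture.HasCompleteNullInfinity 𝒟.toCauchyDevelopment ∧
                ∃ (O : Set 𝒟.carrier) (dd : FinalStateDecomposition 𝒟.toSpacetime O 2),
                  (∀ i, Kerr.IsSubextremal (dd.mass i) (dd.spin i)) ∧
                    O = Summit.FinalStateConjecture.exteriorOf 𝒟.toCauchyDevelopment dd.charted ∧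
                      Summit.FinalStateConjecture.RaysStayInClosure 𝒟.toCauchyDevelopment O ∧
                        Summit.FinalStateConjecture.HasExhaustiveCharts dd ∧
                          Summit.FinalStateConjecture.IsFutureOriented dd) →
          ∃ (e : AFEnd X) (H : EuclideanSpace ℝ (Fin 1) → InitialDataSet (𝓡 3) X),
            InitialDataSet.IsTameDataFamily e 1 H ∧ H 0 = d ∧ (∀ c, H c ∈ admissibleVacuumData X) ∧
              ∀ c ≠ 0, (∃ 𝒟 : VacuumCauchyDevelopment (H c), 𝒟.IsMaximal) ∧
                ∀ 𝒟 : VacuumCauchyDevelopment (H c), 𝒟.IsMaximal →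
                  Summit.FinalStateConjecture.HasCompleteNullInfinity 𝒟.toCauchyDevelopment ∧
                    ∃ (O : Set 𝒟.carrier) (dd : FinalStateDecomposition 𝒟.toSpacetime O 2),
                      (∀ i, Kerr.IsSubextremal (dd.mass i) (dd.spin i)) ∧
                        O = Summit.FinalStateConjecture.exteriorOf 𝒟.toCauchyDevelopment dd.charted ∧
                          Summit.FinalStateConjecture.RaysStayInClosure 𝒟.toCauchyDevelopment O ∧
                            Summit.FinalStateConjecture.HasExhaustiveCharts dd ∧
                              Summit.FinalStateConjecture.IsFutureOriented dd) →
      FinalStateConjecture := by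
  intro h X _ _ _ _ _ _
  exact InitialDataSet.isTameChristodoulouGeneric_one_of_tameCurves
    (fun _ ↦ fun B d t hd ↦ ⟨exists_isMaximal_breatheFamily B d t hd.1, settled_breatheFamily B d t hd.2⟩)
    (h X)

end Summit.FinalStateConjecture.FinalStateConjecture.Theorems.ExactKerrEnds

end
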